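import Mathlib

/-!
# Cross-ratio law for the W3 invariant I(j,k) at g = 6 — the Möbius identities (kernel legs)

Elementary rational identities behind W3-IJKLAW-w3prym2.md v1.1 §4 (pub-hsemireg, widening group W3):
for the Möbius involution `τ x = (P x + S)/(x - P)` with `P = (p q - r s)/((p+q)-(r+s))`,
`S = ((p+q) r s - p q (r+s))/((p+q)-(r+s))` (the involution exchanging `p ↔ q` and `r ↔ s`)
and `Δ = -(P^2 + S)`:
* `tau_swap_p`, `tau_swap_r` : `τ p = q`, `τ r = s`;
* `tau_sub_tau` (M1) : `τ u - τ v = Δ (u - v)/((u-P)(v-P))`;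
* `sub_mul_tau_sub` (M2) : `(x - P)(τ x - P) = -Δ`;
* `residueForm_root` : `(p-r)(p-s)(q-P) = (q-r)(q-s)(p-P)` (the residue form vanishes at `τ ∞ = P`).
Pure field identities over any field; hypotheses are the nonvanishing of the denominators.
Nothing here bears on the Hodge conjecture.
-/

namespace Summit.Ventures.HSemireg.CrossRatioLaw

variable {K : Type*} [Field K]

/-- Pole `P = τ ∞` of the Möbius involution exchanging `p ↔ q` and `r ↔ s`. -/
def poleP (p q r s : K) : K := (p * q - r * s) / ((p + q) - (r + s))

/-- Second coefficient `S` of the involution `τ x = (P x + S)/(x - P)`. -/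
def coefS (p q r s : K) : K := ((p + q) * r * s - p * q * (r + s)) / ((p + q) - (r + s))

/-- The Möbius involution exchanging `p ↔ q` and `r ↔ s`. -/
def tau (p q r s x : K) : K := (poleP p q r s * x + coefS p q r s) / (x - poleP p q r s)

/-- The invariant `Δ = -(P^2 + S)` of the involution. -/
def delta (p q r s : K) : K := -(poleP p q r s ^ 2 + coefS p q r s)

/-- `τ p = q`. -/
theorem tau_swap_p (p q r s : K) (hd : (p + q) - (r + s) ≠ 0) (hp : p - poleP p q r s ≠ 0) :
    tau p q r s p = q := by
  unfold tau
  rw [div_eq_iff hp]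
  unfold poleP coefS at *
  field_simp
  ring

/-- `τ r = s`. -/
theorem tau_swap_r (p q r s : K) (hd : (p + q) - (r + s) ≠ 0) (hr : r - poleP p q r s ≠ 0) :
    tau p q r s r = s := by
  unfold tau
  rw [div_eq_iff hr]
  unfold poleP coefS at *
  field_simp
  ring

/-- (M2) `(x - P)(τ x - P) = -Δ`. -/
theorem sub_mul_tau_sub (p q r s x : K) (hx : x - poleP p q r s ≠ 0) :
    (x - poleP p q r s) * (tau p q r s x - poleP p q r s) = -delta p q r s := by
  unfold tau delta
  field_simp
  ring

/-- (M1) `τ u - τ v = Δ (u - v) / ((u - P)(v - P))`. -/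
theorem tau_sub_tau (p q r s u v : K) (hu : u - poleP p q r s ≠ 0) (hv : v - poleP p q r s ≠ 0) :
    tau p q r s u - tau p q r s v =
      delta p q r s * (u - v) / ((u - poleP p q r s) * (v - poleP p q r s)) := by
  unfold tau delta
  field_simp
  ring

/-- The residue form `L(x) ∝ (p-r)(p-s)(q-x) - (q-r)(q-s)(p-x)` vanishes at `x = P = τ ∞`. -/
theorem residueForm_root (p q r s : K) (hd : (p + q) - (r + s) ≠ 0) :
    (p - r) * (p - s) * (q - poleP p q r s) = (q - r) * (q - s) * (p - poleP p q r s) := by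
  unfold poleP
  field_simp
  ring

/-- `τ` is an involution: `τ (τ x) = x` (trace-zero matrix). -/
theorem tau_tau (p q r s x : K) (hx : x - poleP p q r s ≠ 0) (hΔ : delta p q r s ≠ 0) :
    tau p q r s (tau p q r s x) = x := by
  have h2 : tau p q r s x - poleP p q r s ≠ 0 := by
    intro h
    have := sub_mul_tau_sub p q r s x hx
    rw [h, mul_zero] at this
    exact hΔ (neg_eq_zero.mp this.symm)
  unfold tau at h2 ⊢
  unfold delta at hΔ
  rw [div_eq_iff h2]
  field_simp
  ring

/-- `(p - P)(q - P)(r - P)(s - P) = Δ²` (M2 at `x = p` and `x = r`). -/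
theorem prod_sub_pole (p q r s : K) (hd : (p + q) - (r + s) ≠ 0) :
    (p - poleP p q r s) * (q - poleP p q r s) * (r - poleP p q r s) * (s - poleP p q r s) =
      delta p q r s ^ 2 := by
  unfold delta poleP coefS
  field_simp
  ring

/-- Key relation at the root `p`: `P p + S = q (p - P)` (i.e. `τ p = q` cleared of denominators). -/
theorem pole_key_p (p q r s : K) (hd : (p + q) - (r + s) ≠ 0) :
    poleP p q r s * p + coefS p q r s = q * (p - poleP p q r s) := by
  unfold poleP coefS; field_simp; ring

/-- Key relation at the root `q`: `P q + S = p (q - P)`. -/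
theorem pole_key_q (p q r s : K) (hd : (p + q) - (r + s) ≠ 0) :
    poleP p q r s * q + coefS p q r s = p * (q - poleP p q r s) := by
  unfold poleP coefS; field_simp; ring

/-- Key relation at the root `r`: `P r + S = s (r - P)`. -/
theorem pole_key_r (p q r s : K) (hd : (p + q) - (r + s) ≠ 0) :
    poleP p q r s * r + coefS p q r s = s * (r - poleP p q r s) := by
  unfold poleP coefS; field_simp; ring

/-- Key relation at the root `s`: `P s + S = r (s - P)`. -/
theorem pole_key_s (p q r s : K) (hd : (p + q) - (r + s) ≠ 0) :
    poleP p q r s * s + coefS p q r s = r * (s - poleP p q r s) := by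
  unfold poleP coefS; field_simp; ring

/-- Linear factor for the root `p`: `(τ x - p)(x - P) = (P - p)(x - q)` (uses `τ p = q`). -/
theorem tau_sub_p_mul (p q r s x : K) (hd : (p + q) - (r + s) ≠ 0) (hx : x - poleP p q r s ≠ 0) :
    (tau p q r s x - p) * (x - poleP p q r s) = (poleP p q r s - p) * (x - q) := by
  have key := pole_key_p p q r s hd
  unfold tau; field_simp; linear_combination key

/-- Linear factor for the root `q`: `(τ x - q)(x - P) = (P - q)(x - p)`. -/
theorem tau_sub_q_mul (p q r s x : K) (hd : (p + q) - (r + s) ≠ 0) (hx : x - poleP p q r s ≠ 0) :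
    (tau p q r s x - q) * (x - poleP p q r s) = (poleP p q r s - q) * (x - p) := by
  have key := pole_key_q p q r s hd
  unfold tau; field_simp; linear_combination key

/-- Linear factor for the root `r`: `(τ x - r)(x - P) = (P - r)(x - s)`. -/
theorem tau_sub_r_mul (p q r s x : K) (hd : (p + q) - (r + s) ≠ 0) (hx : x - poleP p q r s ≠ 0) :
    (tau p q r s x - r) * (x - poleP p q r s) = (poleP p q r s - r) * (x - s) := by
  have key := pole_key_r p q r s hd
  unfold tau; field_simp; linear_combination key

/-- Linear factor for the root `s`: `(τ x - s)(x - P) = (P - s)(x - r)`. -/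
theorem tau_sub_s_mul (p q r s x : K) (hd : (p + q) - (r + s) ≠ 0) (hx : x - poleP p q r s ≠ 0) :
    (tau p q r s x - s) * (x - poleP p q r s) = (poleP p q r s - s) * (x - r) := by
  have key := pole_key_s p q r s hd
  unfold tau; field_simp; linear_combination key

/-- `R(τ x) (x - P)^4 = Δ² R(x)` for `R(y) = (y-p)(y-q)(y-r)(y-s)` (τ permutes the roots of `R`). -/
theorem R_tau (p q r s x : K) (hd : (p + q) - (r + s) ≠ 0) (hx : x - poleP p q r s ≠ 0) :
    (tau p q r s x - p) * (tau p q r s x - q) * (tau p q r s x - r) * (tau p q r s x - s) *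
        (x - poleP p q r s) ^ 4 =
      delta p q r s ^ 2 * ((x - p) * (x - q) * (x - r) * (x - s)) := by
  have h1 := tau_sub_p_mul p q r s x hd hx
  have h2 := tau_sub_q_mul p q r s x hd hx
  have h3 := tau_sub_r_mul p q r s x hd hx
  have h4 := tau_sub_s_mul p q r s x hd hx
  have h5 := prod_sub_pole p q r s hd
  calc (tau p q r s x - p) * (tau p q r s x - q) * (tau p q r s x - r) * (tau p q r s x - s) *
        (x - poleP p q r s) ^ 4
      = ((tau p q r s x - p) * (x - poleP p q r s)) * ((tau p q r s x - q) * (x - poleP p q r s)) *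
          ((tau p q r s x - r) * (x - poleP p q r s)) * ((tau p q r s x - s) * (x - poleP p q r s)) := by
        ring
    _ = ((poleP p q r s - p) * (x - q)) * ((poleP p q r s - q) * (x - p)) *
          ((poleP p q r s - r) * (x - s)) * ((poleP p q r s - s) * (x - r)) := by rw [h1, h2, h3, h4]
    _ = ((p - poleP p q r s) * (q - poleP p q r s) * (r - poleP p q r s) * (s - poleP p q r s)) *
          ((x - p) * (x - q) * (x - r) * (x - s)) := by ring
    _ = delta p q r s ^ 2 * ((x - p) * (x - q) * (x - r) * (x - s)) := by rw [h5]

/-- (M1) cleared of denominators: `(τ a - τ x)(a - P)(x - P) = Δ (a - x)`. -/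
theorem tau_sub_tau_mul (p q r s a x : K) (ha : a - poleP p q r s ≠ 0) (hx : x - poleP p q r s ≠ 0) :
    (tau p q r s a - tau p q r s x) * (a - poleP p q r s) * (x - poleP p q r s) =
      delta p q r s * (a - x) := by
  unfold tau delta
  field_simp
  ring

/-- The exchange identity `(τ a - x)(a - P) = -(a - τ x)(x - P)`. -/
theorem tau_sub_mul_exchange (p q r s a x : K) (ha : a - poleP p q r s ≠ 0)
    (hx : x - poleP p q r s ≠ 0) :
    (tau p q r s a - x) * (a - poleP p q r s) = -((a - tau p q r s x) * (x - poleP p q r s)) := by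
  unfold tau
  field_simp
  ring

/-- `n(τ a)/n(a) = -Δ/(a - P)²` for `n(y) = (y - x)(y - τ x)`, cleared of denominators:
`(τ a - x)(τ a - τ x)(a - P)² (x - P) = -Δ (a - x)(a - τ x)(x - P)`. -/
theorem n_tau (p q r s a x : K) (ha : a - poleP p q r s ≠ 0) (hx : x - poleP p q r s ≠ 0) :
    (tau p q r s a - x) * (tau p q r s a - tau p q r s x) * (a - poleP p q r s) ^ 2 *
        (x - poleP p q r s) =
      -delta p q r s * ((a - x) * (a - tau p q r s x)) * (x - poleP p q r s) := by
  have h1 := tau_sub_mul_exchange p q r s a x ha hx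
  have h2 := tau_sub_tau_mul p q r s a x ha hx
  calc (tau p q r s a - x) * (tau p q r s a - tau p q r s x) * (a - poleP p q r s) ^ 2 *
        (x - poleP p q r s)
      = ((tau p q r s a - x) * (a - poleP p q r s)) *
          ((tau p q r s a - tau p q r s x) * (a - poleP p q r s) * (x - poleP p q r s)) := by ring
    _ = -((a - tau p q r s x) * (x - poleP p q r s)) * (delta p q r s * (a - x)) := by rw [h1, h2]
    _ = -delta p q r s * ((a - x) * (a - tau p q r s x)) * (x - poleP p q r s) := by ring

end Summit.Ventures.HSemireg.CrossRatioLaw
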